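import Literature.AnabelianGeometry.SemiGraphs.PSCGraphicTransport
import Literature.AnabelianGeometry.SemiGraphs.PSCProofs

/-!
# [CombGC] Remark 1.1.6 / proof of Theorem 1.6 (ii): the isomorphism `ᾱ : Π^cpt_G ≅ Π^cpt_H` induced by a
# group-theoretically cuspidal `α`, and the FORMAL transfer of conjugacy-class conditions along presentations

Mochizuki, *A combinatorial version of the Grothendieck conjecture*, Tohoku Math. J. **59** (2007) [CombGC],
§1: Definition 1.1 (ii) p. 7 (the quotient `Π_G ↠ Π^cpt_G`, kernel `PSCDatum.cptKer`), Remark 1.1.6 p. 8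
(read on the render `paper:url-6994f81053dc` p0008 l.36–48: "Suppose that `G` is sturdy. Then the quotient
`Π_G ↠ Π^cpt_G` determines a new semi-graph of anabelioids `G′` of PSC-type … which we shall refer to as the
compactification of `G` … we obtain a natural isomorphism `Π^cpt_G ⥲ Π_{G′}`"), and the proof of Theorem 1.6
(ii) p. 14 l.18–21 ("by replacing `G`, `H` by their compactifications, we may assume that `G`, `H` are
noncuspidal").  [cite: MochizukiCombGC2007, Rmk 1.1.6 p.8] [cite: MochizukiCombGC2007, Thm 1.6(ii) p.14]

PROOF-ONLY file (abc-iut cell, layer L3, `plan/L3/SUBDAG-CombGC-Thm16.md` row **T16-L09** "replacing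
`G`, `H` by their compactifications", TRANSFER COMPANION part 1 — the part that needs NO compactification
datum; abc-iut-L3-lead α11-3: def `PSCDatum.compactify`/`compactifyAlong` = abc-iut-L3-t4 g4 (p418457),
transfer companion = abc-iut-w5-d188).  Over `PSCGraphicTransport.lean`
(`map_cptKer_of_isGroupTheoreticallyCuspidal`) and `PSCProofs.lean` (`cptKer_normal`):

* GENERIC, along PRESENTATIONS `f : Π ↠ Q`, `f' : Π' ↠ Q'` and an isomorphism `β : Q ≅ Q'` lying over
  `α : Π ≅ Π'` (`β ∘ f = f' ∘ α`; p418457 presents the compactification along any such `f`,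
  `PSCDatum.compactifyAlong`): `map_map_eq_of_over` (images commute with the square),
  `exists_conjAct_map_eq` (conjugators lift along a surjection), `over_symm_apply` (the inverse lies over
  `α⁻¹`), and **`transport_conj_classes_along`** — the FORMAL TRANSFER of "group-theoretically-𝒳" conditions:
  if `α` carries the `Π`-conjugates of a family `S i ≤ Π` onto the `Π'`-conjugates of a family `T j ≤ Π'`
  and every such conjugate arises (the shape of `IsGroupTheoreticallyVerticial` / nodal classes), then `β`
  does the same for the IMAGE families `i ↦ f(S i)`, `j ↦ f'(T j)` (p418457: `(G.compactifyAlong f …).vertGp v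
  = (G.vertGp v).map f`, nodes likewise);
* GENERIC, quotients: `exists_quotient_equiv_of_map_eq` — `α` carrying a normal subgroup `N` onto a normal
  `N'` induces a topological isomorphism `Π/N ≅ Π'/N'` over the projections (the pattern of
  `exists_unrQuotient_equiv`, once for all quotients); `quotient_equiv_unique`;
* `exists_cptQuotient_equiv`, `IsGroupTheoreticallyCuspidal.exists_cptQuotient_equiv`,
  `IsGraphic.exists_cptQuotient_equiv` — **the isomorphism `ᾱ : Π^cpt_G ≅ Π^cpt_H`** ("replacing `G`, `H` by
  their compactifications") induced by a group-theoretically cuspidal (e.g. graphic) `α`, over the canonical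
  presentations `Π ↠ Π ⧸ cptKer`; `IsGroupTheoreticallyVerticial.transport_cptQuotient` /
  `transport_cptQuotient_nodal` — the verticial / nodal class transfer to `ᾱ`; `IsCuspidal.map_mk'_eq_bot` —
  cuspidal subgroups die in `Π^cpt` ("omitting the cusps").
Part 2 (`PSCCompactificationTransfer.lean`, after p418457 lands) specialises to `compactifyAlong` and adds
the transfer of FILTRATION-preservation.  The DESCENT "`ᾱ` graphic ⇒ `α` graphic" (row T16-L09b) is NOT
formal and is not claimed here.  Pure proofs; no definitions (the normality of `cptKer` — the landed
THEOREM `PSCDatum.cptKer_normal` — enters the `Π^cpt` statements as an instance ARGUMENT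
`[G.cptKer.Normal]`, the convention of p418457); nothing here takes a side on [IUTchIII] Cor. 3.12.
-/

noncomputable section

namespace Literature.AnabelianGeometry.SemiGraphs

namespace PSCDatum

open scoped Pointwise

universe u

variable {P : Type u} [Group P] [TopologicalSpace P]
variable {P' : Type u} [Group P'] [TopologicalSpace P']
variable {Q : Type u} [Group Q] [TopologicalSpace Q]
variable {Q' : Type u} [Group Q'] [TopologicalSpace Q']

/-! ### Generic: transport along presentations `f : Π ↠ Q`, `f' : Π' ↠ Q'` and `β` over `α` -/

section Along

variable {α : P ≃ₜ* P'} {f : P →* Q} {f' : P' →* Q'} {β : Q ≃ₜ* Q'}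

omit [TopologicalSpace P] [TopologicalSpace P'] [TopologicalSpace Q] [TopologicalSpace Q'] in
/-- Every conjugator in `Q` lifts along a surjection `f : Π ↠ Q`.
[cite: MochizukiCombGC2007, Rmk 1.1.6 p.8] -/
theorem exists_conjAct_map_eq (hs : Function.Surjective f) (δ : ConjAct Q) :
    ∃ γ : ConjAct P, ConjAct.toConjAct (f (ConjAct.ofConjAct γ)) = δ := by
  obtain ⟨g, hg⟩ := hs (ConjAct.ofConjAct δ)
  exact ⟨ConjAct.toConjAct g, by rw [ConjAct.ofConjAct_toConjAct, hg, ConjAct.toConjAct_ofConjAct]⟩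

/-- As monoid homomorphisms, `β ∘ f = f' ∘ α` for `β` lying over `α`.
[cite: MochizukiCombGC2007, Rmk 1.1.6 p.8] -/
theorem comp_eq_of_over (hβ : ∀ x : P, β (f x) = f' (α x)) :
    β.toMulEquiv.toMonoidHom.comp f = f'.comp α.toMulEquiv.toMonoidHom :=
  MonoidHom.ext hβ

/-- **Images commute with the square**: for `β` over `α` and every subgroup `B ≤ Π`,
`β(f(B)) = f'(α(B))`. [cite: MochizukiCombGC2007, Rmk 1.1.6 p.8] -/
theorem map_map_eq_of_over (hβ : ∀ x : P, β (f x) = f' (α x)) (B : Subgroup P) :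
    (B.map f).map β.toMulEquiv.toMonoidHom = (B.map α.toMulEquiv.toMonoidHom).map f' := by
  rw [Subgroup.map_map, Subgroup.map_map, comp_eq_of_over hβ]

/-- The inverse of an isomorphism over `α` lies over `α⁻¹` (for surjective `f`).
[cite: MochizukiCombGC2007, Rmk 1.1.6 p.8] -/
theorem over_symm_apply (hβ : ∀ x : P, β (f x) = f' (α x)) (y : P') :
    β.symm (f' y) = f (α.symm y) := by
  apply β.injective
  rw [ContinuousMulEquiv.apply_symm_apply, hβ, ContinuousMulEquiv.apply_symm_apply]

/-- **FORMAL TRANSFER of conjugacy-class conditions along presentations** (the pattern behind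
"replacing `G`, `H` by their compactifications", Thm. 1.6 (ii) p. 14 l.18–21).  Let `f : Π ↠ Q`,
`f' : Π' ↠ Q'` be surjective, `β : Q ≅ Q'` over `α : Π ≅ Π'`, and let `S : ι → Subgroup Π`,
`T : ι' → Subgroup Π'` be families such that `α` carries every `Π`-conjugate of an `S i` to a
`Π'`-conjugate of some `T j`, and every `Π'`-conjugate of a `T j` arises as such an image (e.g. `α`
group-theoretically verticial, `S`/`T` the verticial subgroups).  Then `β` carries every `Q`-conjugate of
an image `f(S i)` to a `Q'`-conjugate of some `f'(T j)`, and every `Q'`-conjugate of an `f'(T j)` arises.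
[cite: MochizukiCombGC2007, Thm 1.6(ii) p.14] -/
theorem transport_conj_classes_along (hs : Function.Surjective f) (hs' : Function.Surjective f')
    (hβ : ∀ x : P, β (f x) = f' (α x)) {ι ι' : Type*} (S : ι → Subgroup P) (T : ι' → Subgroup P')
    (h₁ : ∀ A : Subgroup P, (∃ (i : ι) (γ : ConjAct P), A = γ • S i) →
      ∃ (j : ι') (δ : ConjAct P'), A.map α.toMulEquiv.toMonoidHom = δ • T j)
    (h₂ : ∀ B : Subgroup P', (∃ (j : ι') (δ : ConjAct P'), B = δ • T j) →
      ∃ A : Subgroup P, (∃ (i : ι) (γ : ConjAct P), A = γ • S i) ∧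
        A.map α.toMulEquiv.toMonoidHom = B) :
    (∀ A : Subgroup Q, (∃ (i : ι) (γ : ConjAct Q), A = γ • (S i).map f) →
      ∃ (j : ι') (δ : ConjAct Q'), A.map β.toMulEquiv.toMonoidHom = δ • (T j).map f') ∧
    ∀ B : Subgroup Q', (∃ (j : ι') (δ : ConjAct Q'), B = δ • (T j).map f') →
      ∃ A : Subgroup Q, (∃ (i : ι) (γ : ConjAct Q), A = γ • (S i).map f) ∧
        A.map β.toMulEquiv.toMonoidHom = B := by
  constructor
  · rintro A ⟨i, γ, rfl⟩
    obtain ⟨γ₀, rfl⟩ := exists_conjAct_map_eq hs γ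
    obtain ⟨j, δ, hδ⟩ := h₁ (γ₀ • S i) ⟨i, γ₀, rfl⟩
    refine ⟨j, ConjAct.toConjAct (f' (ConjAct.ofConjAct δ)), ?_⟩
    rw [← map_conj_smul, map_map_eq_of_over hβ, hδ, map_conj_smul]
  · rintro B ⟨j, δ, rfl⟩
    obtain ⟨δ₀, rfl⟩ := exists_conjAct_map_eq hs' δ
    obtain ⟨A, ⟨i, γ, rfl⟩, hA⟩ := h₂ (δ₀ • T j) ⟨j, δ₀, rfl⟩
    exact ⟨(γ • S i).map f, ⟨i, ConjAct.toConjAct (f (ConjAct.ofConjAct γ)), map_conj_smul f γ _⟩,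
      by rw [map_map_eq_of_over hβ, hA, map_conj_smul]⟩

end Along

/-! ### Generic: quotient isomorphisms induced by `α` -/

section Quotient

variable (α : P ≃ₜ* P') (N : Subgroup P) [N.Normal] (N' : Subgroup P') [N'.Normal]

/-- **Induced isomorphism of quotients.**  If the topological isomorphism `α : Π ≅ Π'` carries the normal
subgroup `N` onto the normal subgroup `N'`, it induces a topological group isomorphism `Π/N ≅ Π'/N'`
over the projections (algebraically `QuotientGroup.congr`; continuity in both directions because the
projections are quotient maps). [cite: MochizukiCombGC2007, Def 1.1(ii) p.7] -/
theorem exists_quotient_equiv_of_map_eq (hα : N.map α.toMulEquiv.toMonoidHom = N') :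
    ∃ β : (P ⧸ N) ≃ₜ* (P' ⧸ N'),
      ∀ x : P, β (QuotientGroup.mk' N x) = QuotientGroup.mk' N' (α x) := by
  let e : P ⧸ N ≃* P' ⧸ N' := QuotientGroup.congr N N' α.toMulEquiv hα
  have he : ∀ x : P, e (QuotientGroup.mk x) = QuotientGroup.mk (α x) := fun x => rfl
  have he' : ∀ y : P', e.symm (QuotientGroup.mk y) = QuotientGroup.mk (α.symm y) := fun y => rfl
  have hcont : Continuous e := by
    rw [(QuotientGroup.isQuotientMap_mk N).continuous_iff]
    have : (e : P ⧸ N → P' ⧸ N') ∘ QuotientGroup.mk = QuotientGroup.mk ∘ α := funext he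
    rw [this]
    exact QuotientGroup.continuous_mk.comp α.continuous
  have hcont' : Continuous e.symm := by
    rw [(QuotientGroup.isQuotientMap_mk N').continuous_iff]
    have : (e.symm : P' ⧸ N' → P ⧸ N) ∘ QuotientGroup.mk = QuotientGroup.mk ∘ α.symm := funext he'
    rw [this]
    exact QuotientGroup.continuous_mk.comp α.symm.continuous
  exact ⟨{ e with continuous_toFun := hcont, continuous_invFun := hcont' }, he⟩

variable {α N N'}

/-- **Uniqueness of an isomorphism over `α` along surjective presentations**: two topological
isomorphisms `Q ≅ Q'` lying over `α` coincide. [cite: MochizukiCombGC2007, Def 1.1(ii) p.7] -/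
theorem over_unique {f : P →* Q} (hs : Function.Surjective f) {f' : P' →* Q'} {β β' : Q ≃ₜ* Q'}
    (hβ : ∀ x : P, β (f x) = f' (α x)) (hβ' : ∀ x : P, β' (f x) = f' (α x)) : β = β' := by
  apply ContinuousMulEquiv.ext
  intro q
  obtain ⟨x, rfl⟩ := hs q
  rw [hβ, hβ']

/-- Uniqueness of the induced isomorphism of quotients `Π/N ≅ Π'/N'` over `α`.
[cite: MochizukiCombGC2007, Def 1.1(ii) p.7] -/
theorem quotient_equiv_unique {β β' : (P ⧸ N) ≃ₜ* (P' ⧸ N')}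
    (hβ : ∀ x : P, β (QuotientGroup.mk' N x) = QuotientGroup.mk' N' (α x))
    (hβ' : ∀ x : P, β' (QuotientGroup.mk' N x) = QuotientGroup.mk' N' (α x)) : β = β' :=
  over_unique (QuotientGroup.mk'_surjective N) hβ hβ'

end Quotient

/-! ### The isomorphism `ᾱ : Π^cpt_G ≅ Π^cpt_H` ("replacing `G`, `H` by their compactifications") -/

section Cpt

variable [IsTopologicalGroup P] [IsTopologicalGroup P']
variable {G : PSCDatum P} {H : PSCDatum P'} {α : P ≃ₜ* P'}

/- The quotients `Π ⧸ cptKer` are groups once `cptKer` is known to be normal; the tree records this as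
the THEOREM `PSCDatum.cptKer_normal` (PSCProofs.lean), so the statements below take the normality as an
instance ARGUMENT (discharged by `haveI := G.cptKer_normal`, the convention of `PSCDatum.compactify`,
p418457) — no instance is declared or re-prioritised in this proof-only file. -/
variable [G.cptKer.Normal] [H.cptKer.Normal]

/-- **The isomorphism `ᾱ : Π^cpt_G ≅ Π^cpt_H` induced by `α`**: whenever `α` carries
`Ker(Π_G ↠ Π^cpt_G)` onto `Ker(Π_H ↠ Π^cpt_H)`, there is a topological group isomorphism of the
compactified quotients over the projections (Rmk. 1.1.6: `Π^cpt_G ⥲ Π_{G′}`, `G′` the compactification);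
unique by `quotient_equiv_unique`. [cite: MochizukiCombGC2007, Rmk 1.1.6 p.8] -/
theorem exists_cptQuotient_equiv (hα : G.cptKer.map α.toMulEquiv.toMonoidHom = H.cptKer) :
    ∃ β : (P ⧸ G.cptKer) ≃ₜ* (P' ⧸ H.cptKer),
      ∀ x : P, β (QuotientGroup.mk' G.cptKer x) = QuotientGroup.mk' H.cptKer (α x) :=
  exists_quotient_equiv_of_map_eq α G.cptKer H.cptKer hα

/-- **A group-theoretically cuspidal `α` induces `ᾱ : Π^cpt_G ≅ Π^cpt_H`** over the projections — the
isomorphism between the fundamental groups of the COMPACTIFICATIONS used in the proof of Thm. 1.6 (ii)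
("by replacing `G`, `H` by their compactifications"). [cite: MochizukiCombGC2007, Thm 1.6(ii) p.14] -/
theorem IsGroupTheoreticallyCuspidal.exists_cptQuotient_equiv (h : G.IsGroupTheoreticallyCuspidal H α) :
    ∃ β : (P ⧸ G.cptKer) ≃ₜ* (P' ⧸ H.cptKer),
      ∀ x : P, β (QuotientGroup.mk' G.cptKer x) = QuotientGroup.mk' H.cptKer (α x) :=
  PSCDatum.exists_cptQuotient_equiv (map_cptKer_of_isGroupTheoreticallyCuspidal h)

/-- A graphic `α` induces `ᾱ : Π^cpt_G ≅ Π^cpt_H` over the projections (graphic ⇒ group-theoretically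
cuspidal, Prop. 1.5 (ii) ⇒). [cite: MochizukiCombGC2007, Prop 1.5(ii) p.13] -/
theorem IsGraphic.exists_cptQuotient_equiv (h : G.IsGraphic H α) :
    ∃ β : (P ⧸ G.cptKer) ≃ₜ* (P' ⧸ H.cptKer),
      ∀ x : P, β (QuotientGroup.mk' G.cptKer x) = QuotientGroup.mk' H.cptKer (α x) :=
  h.isGroupTheoreticallyCuspidal.exists_cptQuotient_equiv

/-- **Transfer, verticial classes**: for a group-theoretically VERTICIAL `α` and any `ᾱ : Π^cpt_G ≅ Π^cpt_H`
over `α`, `ᾱ` carries the `Π^cpt_G`-conjugates of the images `Π̄_v` of the verticial subgroups onto the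
`Π^cpt_H`-conjugates of the images `Π̄_w`, and every such conjugate arises — `ᾱ` is group-theoretically
verticial for the image families (= the compactifications' verticial subgroups, p418457
`compactifyAlong_vertGp`). [cite: MochizukiCombGC2007, Thm 1.6(ii) p.14] -/
theorem IsGroupTheoreticallyVerticial.transport_cptQuotient (h : G.IsGroupTheoreticallyVerticial H α)
    {β : (P ⧸ G.cptKer) ≃ₜ* (P' ⧸ H.cptKer)}
    (hβ : ∀ x : P, β (QuotientGroup.mk' G.cptKer x) = QuotientGroup.mk' H.cptKer (α x)) :
    (∀ A : Subgroup (P ⧸ G.cptKer), (∃ (v : G.graph.V) (γ : ConjAct (P ⧸ G.cptKer)),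
        A = γ • (G.vertGp v).map (QuotientGroup.mk' G.cptKer)) →
      ∃ (w : H.graph.V) (δ : ConjAct (P' ⧸ H.cptKer)),
        A.map β.toMulEquiv.toMonoidHom = δ • (H.vertGp w).map (QuotientGroup.mk' H.cptKer)) ∧
    ∀ B : Subgroup (P' ⧸ H.cptKer), (∃ (w : H.graph.V) (δ : ConjAct (P' ⧸ H.cptKer)),
        B = δ • (H.vertGp w).map (QuotientGroup.mk' H.cptKer)) →
      ∃ A : Subgroup (P ⧸ G.cptKer), (∃ (v : G.graph.V) (γ : ConjAct (P ⧸ G.cptKer)),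
        A = γ • (G.vertGp v).map (QuotientGroup.mk' G.cptKer)) ∧
        A.map β.toMulEquiv.toMonoidHom = B :=
  transport_conj_classes_along (QuotientGroup.mk'_surjective _) (QuotientGroup.mk'_surjective _) hβ
    G.vertGp H.vertGp
    (fun A ⟨v, γ, hA⟩ => by
      obtain ⟨w, δ, h'⟩ := h.1 A ⟨v, γ, hA⟩
      exact ⟨w, δ, h'⟩)
    (fun B ⟨w, δ, hB⟩ => by
      obtain ⟨A, ⟨v, γ, hA⟩, hAB⟩ := h.2 B ⟨w, δ, hB⟩
      exact ⟨A, ⟨v, γ, hA⟩, hAB⟩)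

/-- **Transfer, nodal classes**: if `α` carries nodal classes to nodal classes and back, then any `ᾱ`
over `α` does the same for the image families `e ↦ Π̄_e` (= the compactifications' nodal = edge-like
subgroups, p418457 `compactifyAlong_nodeGp` / `isEdgeLike_compactifyAlong_iff`).
[cite: MochizukiCombGC2007, Thm 1.6(ii) p.14] -/
theorem transport_cptQuotient_nodal
    (h₁ : ∀ A, G.IsNodal A → H.IsNodal (A.map α.toMulEquiv.toMonoidHom))
    (h₂ : ∀ B, H.IsNodal B → ∃ A, G.IsNodal A ∧ A.map α.toMulEquiv.toMonoidHom = B)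
    {β : (P ⧸ G.cptKer) ≃ₜ* (P' ⧸ H.cptKer)}
    (hβ : ∀ x : P, β (QuotientGroup.mk' G.cptKer x) = QuotientGroup.mk' H.cptKer (α x)) :
    (∀ A : Subgroup (P ⧸ G.cptKer), (∃ (e : G.graph.N) (γ : ConjAct (P ⧸ G.cptKer)),
        A = γ • (G.nodeGp e).map (QuotientGroup.mk' G.cptKer)) →
      ∃ (e' : H.graph.N) (δ : ConjAct (P' ⧸ H.cptKer)),
        A.map β.toMulEquiv.toMonoidHom = δ • (H.nodeGp e').map (QuotientGroup.mk' H.cptKer)) ∧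
    ∀ B : Subgroup (P' ⧸ H.cptKer), (∃ (e' : H.graph.N) (δ : ConjAct (P' ⧸ H.cptKer)),
        B = δ • (H.nodeGp e').map (QuotientGroup.mk' H.cptKer)) →
      ∃ A : Subgroup (P ⧸ G.cptKer), (∃ (e : G.graph.N) (γ : ConjAct (P ⧸ G.cptKer)),
        A = γ • (G.nodeGp e).map (QuotientGroup.mk' G.cptKer)) ∧
        A.map β.toMulEquiv.toMonoidHom = B :=
  transport_conj_classes_along (QuotientGroup.mk'_surjective _) (QuotientGroup.mk'_surjective _) hβ
    G.nodeGp H.nodeGp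
    (fun A ⟨e, γ, hA⟩ => by
      obtain ⟨e', δ, h'⟩ := h₁ A ⟨e, γ, hA⟩
      exact ⟨e', δ, h'⟩)
    (fun B ⟨e', δ, hB⟩ => by
      obtain ⟨A, ⟨e, γ, hA⟩, hAB⟩ := h₂ B ⟨e', δ, hB⟩
      exact ⟨A, ⟨e, γ, hA⟩, hAB⟩)

omit [IsTopologicalGroup P'] [H.cptKer.Normal] in
/-- The images of the CUSPIDAL subgroups die in `Π^cpt`: `Π̄_c = 1` (the compactification "omits the
cusps", Rmk. 1.1.6). [cite: MochizukiCombGC2007, Rmk 1.1.6 p.8] -/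
theorem map_mk'_cuspGp_eq_bot (c : G.graph.C) :
    (G.cuspGp c).map (QuotientGroup.mk' G.cptKer) = ⊥ := by
  rw [eq_bot_iff]
  rintro _ ⟨x, hx, rfl⟩
  rw [Subgroup.mem_bot, QuotientGroup.mk'_apply, QuotientGroup.eq_one_iff]
  exact G.cuspGp_le_cptKer c hx

omit [IsTopologicalGroup P'] [H.cptKer.Normal] in
/-- Every CUSPIDAL subgroup of `Π_G` has trivial image in `Π^cpt_G`. [cite: MochizukiCombGC2007, Rmk 1.1.6 p.8] -/
theorem IsCuspidal.map_mk'_eq_bot {A : Subgroup P} (hA : G.IsCuspidal A) :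
    A.map (QuotientGroup.mk' G.cptKer) = ⊥ := by
  obtain ⟨c, γ, rfl⟩ := hA
  rw [map_conj_smul, map_mk'_cuspGp_eq_bot, Subgroup.smul_bot]

end Cpt

end PSCDatum

end Literature.AnabelianGeometry.SemiGraphs
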